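import Summits.Ventures.QEC.Census.BB.BB72.Cert
import Summits.Ventures.QEC.Census.BB.BB72Index
import Summits.Ventures.QEC.Theses.BB72DistanceCertificate
import HarnessLib

/-!
# Route BB72DistanceCertificate, item WeightSixZLogical (stmt-Ventures-19878): `BB.bb72` has a `Z`-logical of
# weight exactly `6`

The kernel-A certificate `cert/BB72.certA.json` (id `7e943c5a…`, qec-search-1; emitted as `BB72.cert : DistCert` by
qec-search-7) lists the upper witness `upper.witness_Z`: a weight-6 `Z`-type operator `w` with zero `H^X`-syndrome
and a NON-MEMBERSHIP witness `u` (`H^Z u = 0`, `|u ∩ w|` odd ⇒ `w ∉ rowspace H^Z`, type-02's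
`not_mem_rowSpace_of_witness`). The structural part of type-10's checker (`DistCert.checkStructure`: commutation,
both upper witnesses, allow-list decompositions) is evaluated by `decide +kernel` (`structure_ok'`), its soundness
`upper_sound` gives the flat witness, and type-05's `BB.Code.zWitness_of_flat` transports it to the typed code
`BB.bb72` through the kernel-checked index identity `rowMatrix 72 cert.HX = BB.bb72.HXFlat` (certificate literal
= generator file `BB72Index` = typed code). Tier KERNEL; no `native_decide`; this file does not import `Params.lean`
(the row-assembly file of record), so that the route item closes independently of it.
-/

namespace Summit.Ventures.QEC.Census.BB72

open Matrix Literature.InformationTheory.QuantumCodes Summit.Ventures.QEC.BB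

/-- The structural part of the certificate check passes (kernel `decide`): `H^X (H^Z)ᵀ = 0`, both upper witnesses
(weight 6, zero syndrome, odd overlap with their non-membership witnesses), allow-list decompositions. -/
theorem structure_ok' : cert.checkStructure = true := by
  decide +kernel

/-- The certificate's `H^X` is the generator file's `HX` (`BB72Index`), entry for entry. -/
theorem rowMatrix_HX_eq' : rowMatrix cert.n cert.HX = ofSupports bb72SupportsX := by
  ext i j
  decide +revert

/-- The certificate's `H^Z` is the generator file's `HZ`, entry for entry. -/
theorem rowMatrix_HZ_eq' : rowMatrix cert.n cert.HZ = ofSupports bb72SupportsZ := by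
  ext i j
  decide +revert

/-- **Item WeightSixZLogical, PROVED**: some `Z`-type logical operator of `BB.bb72` has Hamming weight exactly `6`
— the certificate's upper witness, checked in the kernel and transported to the typed code. -/
theorem weightSixZLogical_proof : Summit.Ventures.QEC.Theses.BB72DistanceCertificate.WeightSixZLogical := by
  have h := structure_ok'
  simp only [DistCert.checkStructure, Bool.and_eq_true] at h
  obtain ⟨hv, hv', hwt⟩ := upper_sound h.1.1.1.2
  exact BB.bb72.zWitness_of_flat (D := cert.code (cert.commOK_of_checkStructure structure_ok'))
    (rowMatrix_HX_eq'.trans bb72_HXFlat_eq_ofSupports.symm) (rowMatrix_HZ_eq'.trans bb72_HZFlat_eq_ofSupports.symm)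
    ⟨ofBits cert.n cert.sideZ.witness, hv, hv', hwt⟩

end Summit.Ventures.QEC.Census.BB72
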